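import Summits.Ventures.PercRepro.S2ThirteenEightModNuFour
import Summits.Ventures.PercRepro.S2ThirteenEightNuFour
import Summits.Ventures.PercRepro.S2TwelveEightK1NuFour
import Summits.Ventures.PercRepro.S2ElevenEightK2NuFour

/-!
# PercRepro — S2: THE CELL `(13, 8)` IS A THEOREM (p7, gen 18; sub-claim S2; the row `p = 13`)

The three `ν = 4` cases of `c025_core_five_thirteen_eight_of_nu_four` (S2ThirteenEightModNuFour) are theorems: `c025_thirteen_eight_cf_nu_four`
(the coloop-free cell `(13, 8)`), `c025_twelve_eight_cfk1_nu_four` (its scaled sub-cell `(12, 8)` at `K₁ = 10219`) and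
`c025_eleven_eight_k2_nu_four` (its twice-scaled sub-cell `(11, 8)` at `K₂ = 12107`, coloops allowed) — each by the split of the `ν = 4`
regime by the largest set of rank `6` (a nullity-`7` set on `≤ 13` points by the kit's hitting counts; a `12`-point rank-`6` flat by the
exact-rank lever with a nullity-`2` contraction; an `11`-point rank-`6` flat with a nullity-`3` contraction counted through one deletion;
else a simple contraction of the nullity-`4` flat). Hence **`c025_core_five_thirteen_eight (M) [M.Finite] (hR : M.eRank = 13)
(hn : M.E.ncard = 13 + 8) (hfree) : RLS M 13 5`** — THE CELL `(13, 8)` OF THE `q = 5` WINDOW OF `C025`, UNCONDITIONAL. Nothing else is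
claimed. Axioms: standard.
-/

open scoped Matroid

namespace PercRepro

namespace ThmN

open Set

variable {α : Type}

/-- **The cell `(13, 8)` of the `q = 5` window**: every `e`-free core of rank `13` on `21` points satisfies `RLS M 13 5`. -/
theorem c025_core_five_thirteen_eight (M : Matroid α) [M.Finite]
    (hR : M.eRank = ((13 : ℕ) : ℕ∞)) (hn : M.E.ncard = 13 + 8)
    (hfree : ∀ e ∈ M.E, ∃ A ⊆ M.E \ {e}, e ∉ M.closure A ∧ e ∉ M.closure ((M.E \ {e}) \ A)) : RLS M 13 5 :=
  c025_core_five_thirteen_eight_of_nu_four c025_thirteen_eight_cf_nu_four c025_twelve_eight_cfk1_nu_four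
    c025_eleven_eight_k2_nu_four M hR hn hfree

end ThmN

end PercRepro
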